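import Literature.NumberTheory.LFunctions.SelbergDelangeCappedEulerProduct
import Literature.NumberTheory.LFunctions.SelbergDelangeRieszExpansion
import HarnessLib

/-!
# The capped Euler product as Selberg–Delange engine data (stub `stub_cappedEulerData`)

Line `jensen-stieltjes-majorant` of crux stmt-Parity-11327
(`Summit.Parity.BatemanHorn.Theses.AlmostPrimeZeros.LinearCappedRepulsion`).

For `s(n) = Σ_{p^v ∥ n} min(v, 2)` and `a_z(n) = z^{s(n)}` (tree:
`Literature/NumberTheory/LFunctions/SelbergDelangeCappedEulerProduct.lean` — Euler product of
`Σ a_z(n) n^{-s}`, quadratic closeness and the explicit bound `‖E_p‖ ≤ exp(30 (1+R)^{3/2} ‖p^{-s}‖^{3/2})`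
of Selberg's factors `E_p(s, z) = (1 + z q + z² q²/(1 − q)) exp(z Log(1 − q))`, `q = p^{-s}`), this file
proves:

* `F(s, z) = ∏_p E_p(s, z)` converges locally uniformly on `σ > σ₀ > 1/2` for EVERY `z` and is
  holomorphic there (`hasProdLocallyUniformlyOn_factor`, `differentiableOn_tprod_factor`; the
  factors are `1 + O((|z|+|z|²) p^{-2σ₀})` eventually in `p`);
* `Σ z^{s(n)} n^{-s} = ζ(s)^z F(s, z)` on `σ > 1` (`LSeries_eq`, with the tree's branch
  `SelbergDelange.zetaPow z s = exp(z Σ_p −Log(1 − p^{-s}))`);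
* the EXPLICIT bound `‖F(s, z)‖ ≤ exp(30 S (1+R)^{3/2})` for `σ > 4/5`, `‖z‖ ≤ R`, `S = Σ_p p^{-6/5}`
  (`norm_tprod_factor_le`: termwise, `(p^{-σ})^{3/2} ≤ p^{-6/5}`);
* the majorant `Σ ‖a_z(n)‖ n^{-σ} = ζ(σ)^{|z|} F(σ, |z|) ≤ e^{(30 S + 1)(1+R)^{3/2}} (σ − 1)^{-R}` for
  `1 < σ ≤ 2` (`tsum_norm_term_le`: `ζ(σ) ≤ σ/(σ−1)`, `σ^R ≤ 2^R ≤ e^{(1+R)^{3/2}}`);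
* **`stub_cappedEulerData`**: `SelbergDelange.RieszData R (4/5) (exp(b (1+R)^{3/2})) z a_z (F(·, z))`
  with `b = 30 S + 1`, for every `R ≥ 0`, `‖z‖ ≤ R` (no `R < 2` wall: the capped factor is a
  polynomial in `z`).

Theorem-only file (no definitions, no notation). Models: `SatheSelbergEulerProduct.lean`,
`SelbergDelangeOmegaEulerProduct.lean`, `SelbergDelange.MeanValue717.rieszData_zetaPowCoeff`.
References: H. L. Montgomery, R. C. Vaughan, *Multiplicative Number Theory I*, CUP 2007, §7.4
(Theorems 7.17–7.18, (7.60)); G. Tenenbaum, *Introduction to analytic and probabilistic number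
theory*, 3rd ed., II.5.
-/

noncomputable section

open Complex LSeries Filter Topology Finset
open Literature.NumberTheory.LFunctions Literature.NumberTheory.LFunctions.SelbergDelangeCapped

namespace Summit.Parity.BatemanHorn.Cruxes.LinearCappedRepulsion.JensenStieltjesMajorant

namespace CappedEuler

/-! ### The factors at the primes: holomorphy and locally uniform convergence of `F(s, z)` -/

/-- For a prime `p` and `σ ≥ 1/2`: `‖p^{-s}‖ ≤ 2^{-1/2} ≤ 3/4`. -/
theorem norm_primes_cpow_le (p : Nat.Primes) {s : ℂ} (hs : 1 / 2 ≤ s.re) :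
    ‖(p : ℂ) ^ (-s)‖ ≤ 3 / 4 := by
  rw [SatheSelberg.norm_primes_cpow_neg]
  have hp2 : (2 : ℝ) ≤ ((p : ℕ) : ℝ) := by exact_mod_cast p.prop.two_le
  calc ((p : ℕ) : ℝ) ^ (-s.re) ≤ (2 : ℝ) ^ (-s.re) :=
        Real.rpow_le_rpow_of_nonpos (by norm_num) hp2 (by linarith)
    _ ≤ (2 : ℝ) ^ (-(1 / 2 : ℝ)) := Real.rpow_le_rpow_of_exponent_le (by norm_num) (by linarith)
    _ ≤ 3 / 4 := PartialEuler.two_rpow_neg_half_le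

/-- Each factor `E_p(·, z)` is holomorphic on `σ > 0`. -/
theorem differentiableAt_factor (p : Nat.Primes) (z : ℂ) {s : ℂ} (hs : 0 < s.re) :
    DifferentiableAt ℂ (fun s : ℂ ↦ (1 + z * (p : ℂ) ^ (-s) + z ^ 2 * ((p : ℂ) ^ (-s)) ^ 2 /
      (1 - (p : ℂ) ^ (-s))) * exp (z * log (1 - (p : ℂ) ^ (-s)))) s := by
  have hq : DifferentiableAt ℂ (fun w : ℂ ↦ (p : ℂ) ^ (-w)) s :=
    differentiableAt_id.neg.const_cpow (Or.inl (by exact_mod_cast p.prop.ne_zero))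
  have h1q : DifferentiableAt ℂ (fun w : ℂ ↦ 1 - (p : ℂ) ^ (-w)) s :=
    (differentiableAt_const _).sub hq
  have hne : (1 : ℂ) - (p : ℂ) ^ (-s) ≠ 0 :=
    slitPlane_ne_zero (SatheSelberg.one_sub_prime_cpow_mem_slitPlane p hs)
  have hlog : DifferentiableAt ℂ (fun w : ℂ ↦ log (1 - (p : ℂ) ^ (-w))) s :=
    h1q.clog (SatheSelberg.one_sub_prime_cpow_mem_slitPlane p hs)
  exact ((((differentiableAt_const _).add ((differentiableAt_const _).mul hq)).add
    (((differentiableAt_const _).mul (hq.pow 2)).div h1q hne)).mul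
      ((differentiableAt_const _).mul hlog).cexp)

/-- **Locally uniform convergence of `F(s, z) = ∏_p E_p(s, z)` in `s` on `σ > σ₀ > 1/2`** (every `z`):
eventually in `p` (once `|z| p^{-σ₀} ≤ 1/4`) the quadratic closeness gives
`‖E_p(s, z) − 1‖ ≤ 20(|z| + |z|²) p^{-2σ₀}` uniformly on `σ ≥ σ₀`, a summable majorant. -/
theorem hasProdLocallyUniformlyOn_factor (z : ℂ) {σ₀ : ℝ} (hσ₀ : 1 / 2 < σ₀) :
    HasProdLocallyUniformlyOn
      (fun (p : Nat.Primes) (s : ℂ) ↦ (1 + z * (p : ℂ) ^ (-s) + z ^ 2 * ((p : ℂ) ^ (-s)) ^ 2 /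
        (1 - (p : ℂ) ^ (-s))) * exp (z * log (1 - (p : ℂ) ^ (-s))))
      (fun s ↦ ∏' p : Nat.Primes, (1 + z * (p : ℂ) ^ (-s) + z ^ 2 * ((p : ℂ) ^ (-s)) ^ 2 /
        (1 - (p : ℂ) ^ (-s))) * exp (z * log (1 - (p : ℂ) ^ (-s))))
      {s : ℂ | σ₀ < s.re} := by
  set E : Nat.Primes → ℂ → ℂ := fun p s ↦ (1 + z * (p : ℂ) ^ (-s) + z ^ 2 * ((p : ℂ) ^ (-s)) ^ 2 /
    (1 - (p : ℂ) ^ (-s))) * exp (z * log (1 - (p : ℂ) ^ (-s))) with hE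
  have hK : IsOpen {s : ℂ | σ₀ < s.re} := isOpen_lt continuous_const continuous_re
  have hu : Summable fun p : Nat.Primes ↦ 20 * (‖z‖ + ‖z‖ ^ 2) * ((p : ℕ) : ℝ) ^ (-(2 * σ₀)) :=
    ((Nat.Primes.summable_rpow (r := -(2 * σ₀))).2 (by linarith)).mul_left _
  -- the quadratic bound, eventually in `p`, uniformly on `σ ≥ σ₀`
  have hev : ∀ᶠ p : Nat.Primes in cofinite, ∀ s ∈ {s : ℂ | σ₀ < s.re},
      ‖E p s - 1‖ ≤ 20 * (‖z‖ + ‖z‖ ^ 2) * ((p : ℕ) : ℝ) ^ (-(2 * σ₀)) := by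
    have hδ : (0 : ℝ) < 1 / (4 * (‖z‖ + 1)) := by positivity
    filter_upwards [(SatheSelberg.tendsto_primes_rpow_neg (by linarith : 0 < σ₀)).eventually
      (Iio_mem_nhds hδ)] with p hp s hs
    have hs' : σ₀ ≤ s.re := le_of_lt hs
    have hp1 : (1 : ℝ) ≤ ((p : ℕ) : ℝ) := by exact_mod_cast p.prop.one_lt.le
    have hmono : ((p : ℕ) : ℝ) ^ (-s.re) ≤ ((p : ℕ) : ℝ) ^ (-σ₀) :=
      Real.rpow_le_rpow_of_exponent_le hp1 (by linarith)
    have hzq : ‖z‖ * ‖(p : ℂ) ^ (-s)‖ ≤ 1 / 4 := by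
      rw [SatheSelberg.norm_primes_cpow_neg]
      calc ‖z‖ * ((p : ℕ) : ℝ) ^ (-s.re) ≤ ‖z‖ * (1 / (4 * (‖z‖ + 1))) :=
            mul_le_mul_of_nonneg_left (hmono.trans (Set.mem_Iio.1 hp).le) (norm_nonneg _)
        _ ≤ 1 / 4 := by
            rw [mul_one_div, div_le_div_iff₀ (by positivity) (by norm_num)]
            nlinarith [norm_nonneg z]
    refine (norm_capFactor_sub_one_le (norm_primes_cpow_le p (by linarith)) hzq).trans ?_
    rw [SatheSelberg.norm_primes_cpow_neg]
    have h2 : (((p : ℕ) : ℝ) ^ (-s.re)) ^ 2 ≤ ((p : ℕ) : ℝ) ^ (-(2 * σ₀)) := by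
      rw [← Real.rpow_natCast, ← Real.rpow_mul (Nat.cast_nonneg _)]
      exact Real.rpow_le_rpow_of_exponent_le hp1 (by push_cast; linarith)
    gcongr
  have hcts : ∀ p : Nat.Primes, ContinuousOn (fun s ↦ E p s - 1) {s : ℂ | σ₀ < s.re} :=
    fun p s hs ↦ ((differentiableAt_factor p z
      (by simp only [Set.mem_setOf_eq] at hs; linarith)).continuousAt.sub
        continuousAt_const).continuousWithinAt
  have h := Summable.hasProdLocallyUniformlyOn_one_add hK hu hev hcts
  simp only [add_sub_cancel] at h
  exact h

/-- **`F(·, z)` is holomorphic on `σ > σ₀`** for every `σ₀ > 1/2` (locally uniform limit of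
holomorphic finite products). -/
theorem differentiableOn_tprod_factor (z : ℂ) {σ₀ : ℝ} (hσ₀ : 1 / 2 < σ₀) :
    DifferentiableOn ℂ (fun s ↦ ∏' p : Nat.Primes, (1 + z * (p : ℂ) ^ (-s) +
      z ^ 2 * ((p : ℂ) ^ (-s)) ^ 2 / (1 - (p : ℂ) ^ (-s))) * exp (z * log (1 - (p : ℂ) ^ (-s))))
      {s : ℂ | σ₀ < s.re} := by
  set E : Nat.Primes → ℂ → ℂ := fun p s ↦ (1 + z * (p : ℂ) ^ (-s) + z ^ 2 * ((p : ℂ) ^ (-s)) ^ 2 /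
    (1 - (p : ℂ) ^ (-s))) * exp (z * log (1 - (p : ℂ) ^ (-s))) with hE
  have hK : IsOpen {s : ℂ | σ₀ < s.re} := isOpen_lt continuous_const continuous_re
  have hdiff : ∀ᶠ S : Finset Nat.Primes in atTop,
      DifferentiableOn ℂ (fun s ↦ ∏ p ∈ S, E p s) {s : ℂ | σ₀ < s.re} := by
    refine Eventually.of_forall fun S ↦ ?_
    rw [← Finset.prod_fn S E]
    refine DifferentiableOn.finsetProd fun p _ w hw ↦ ?_
    exact (differentiableAt_factor p z (by
      simp only [Set.mem_setOf_eq] at hw; linarith)).differentiableWithinAt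
  exact TendstoLocallyUniformlyOn.differentiableOn (hasProdLocallyUniformlyOn_factor z hσ₀) hdiff hK

/-! ### `Σ z^{s(n)} n^{-s} = ζ(s)^z F(s, z)` and the explicit bounds -/

/-- **`Σ z^{s(n)} n^{-s} = ζ(s)^z · F(s, z)` for `σ > 1`** (`ζ(s)^z = exp(z Σ_p −Log(1 − p^{-s}))`,
`SelbergDelange.zetaPow_eq_exp_eulerLogZeta`). -/
theorem LSeries_eq (z : ℂ) {s : ℂ} (hs : 1 < s.re) :
    LSeries (fun n : ℕ ↦ z ^ (n.factorization.sum fun _ v => min v 2)) s =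
      SelbergDelange.zetaPow z s * ∏' p : Nat.Primes, (1 + z * (p : ℂ) ^ (-s) +
        z ^ 2 * ((p : ℂ) ^ (-s)) ^ 2 / (1 - (p : ℂ) ^ (-s))) * exp (z * log (1 - (p : ℂ) ^ (-s))) := by
  obtain ⟨σ₀, h1, h2⟩ := exists_between (by linarith : 1 / 2 < s.re)
  have hF := (hasProdLocallyUniformlyOn_factor z h1).hasProd h2
  have hL : HasProd (fun p : Nat.Primes ↦ exp (z * -log (1 - (p : ℂ) ^ (-s))))
      (exp (z * eulerLogZeta s)) := ((SatheSelberg.hasSum_eulerLogZeta hs).mul_left z).cexp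
  have hprod := hF.mul hL
  have heq : (fun p : Nat.Primes ↦ (1 + z * (p : ℂ) ^ (-s) + z ^ 2 * ((p : ℂ) ^ (-s)) ^ 2 /
      (1 - (p : ℂ) ^ (-s))) * exp (z * log (1 - (p : ℂ) ^ (-s))) *
        exp (z * -log (1 - (p : ℂ) ^ (-s)))) =
      fun p : Nat.Primes ↦ 1 + z * (p : ℂ) ^ (-s) + z ^ 2 * ((p : ℂ) ^ (-s)) ^ 2 /
        (1 - (p : ℂ) ^ (-s)) := by
    funext p
    rw [mul_assoc, ← exp_add, mul_neg, add_neg_cancel, exp_zero, mul_one]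
  rw [heq] at hprod
  rw [(hasProd_LSeries z hs).unique hprod, SelbergDelange.zetaPow_eq_exp_eulerLogZeta z hs,
    mul_comm]

/-- **The explicit bound for `F`**: `‖F(s, z)‖ ≤ exp(30 S (1+R)^{3/2})` for `σ > 4/5`, `‖z‖ ≤ R`,
`S = Σ_p p^{-6/5}` (each factor is `≤ exp(30 (1+R)^{3/2} p^{-3σ/2})` and `3σ/2 ≥ 6/5`). -/
theorem norm_tprod_factor_le {s z : ℂ} {R : ℝ} (hs : 4 / 5 < s.re) (hz : ‖z‖ ≤ R) :
    ‖∏' p : Nat.Primes, (1 + z * (p : ℂ) ^ (-s) + z ^ 2 * ((p : ℂ) ^ (-s)) ^ 2 /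
        (1 - (p : ℂ) ^ (-s))) * exp (z * log (1 - (p : ℂ) ^ (-s)))‖ ≤
      Real.exp (30 * (∑' p : Nat.Primes, ((p : ℕ) : ℝ) ^ (-(6 / 5 : ℝ))) * (1 + R) ^ (3 / 2 : ℝ)) := by
  set E : Nat.Primes → ℂ := fun p ↦ (1 + z * (p : ℂ) ^ (-s) + z ^ 2 * ((p : ℂ) ^ (-s)) ^ 2 /
    (1 - (p : ℂ) ^ (-s))) * exp (z * log (1 - (p : ℂ) ^ (-s))) with hE
  have hR : 0 ≤ R := (norm_nonneg z).trans hz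
  have hsum : Summable fun p : Nat.Primes ↦ ((p : ℕ) : ℝ) ^ (-(6 / 5 : ℝ)) :=
    Nat.Primes.summable_rpow.2 (by norm_num)
  have h0 : ∀ p : Nat.Primes, 0 ≤ ((p : ℕ) : ℝ) ^ (-(6 / 5 : ℝ)) := fun p ↦
    Real.rpow_nonneg (Nat.cast_nonneg _) _
  set S : ℝ := ∑' p : Nat.Primes, ((p : ℕ) : ℝ) ^ (-(6 / 5 : ℝ)) with hS
  set M : ℝ := (1 + R) ^ (3 / 2 : ℝ) with hM
  have hM0 : 0 ≤ M := Real.rpow_nonneg (by linarith) _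
  have hp : ∀ p : Nat.Primes, ‖E p‖ ≤ Real.exp (30 * M * ((p : ℕ) : ℝ) ^ (-(6 / 5 : ℝ))) := by
    intro p
    refine (norm_capFactor_le (norm_primes_cpow_le p (by linarith)) hz).trans ?_
    rw [Real.exp_le_exp, SatheSelberg.norm_primes_cpow_neg, ← Real.rpow_mul (Nat.cast_nonneg _),
      mul_assoc]
    refine mul_le_mul_of_nonneg_left (mul_le_mul_of_nonneg_left ?_ hM0) (by norm_num)
    exact Real.rpow_le_rpow_of_exponent_le (by exact_mod_cast p.prop.one_lt.le) (by linarith)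
  obtain ⟨σ₀, h1, h2⟩ := exists_between (by linarith : 1 / 2 < s.re)
  refine hasProd_le_of_prod_le ((hasProdLocallyUniformlyOn_factor z h1).hasProd h2).norm
    fun T ↦ ?_
  calc ∏ p ∈ T, ‖E p‖ ≤ ∏ p ∈ T, Real.exp (30 * M * ((p : ℕ) : ℝ) ^ (-(6 / 5 : ℝ))) :=
        Finset.prod_le_prod (fun p _ ↦ norm_nonneg _) fun p _ ↦ hp p
    _ = Real.exp (30 * M * ∑ p ∈ T, ((p : ℕ) : ℝ) ^ (-(6 / 5 : ℝ))) := by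
        rw [Finset.mul_sum, Real.exp_sum]
    _ ≤ Real.exp (30 * S * M) := by
        rw [Real.exp_le_exp]
        have := sum_le_hasSum T (fun p _ ↦ h0 p) hsum.hasSum
        nlinarith [mul_le_mul_of_nonneg_left this hM0]

/-- **The majorant**: for `‖z‖ ≤ R` and `1 < σ ≤ 2`,
`Σ ‖z^{s(n)} n^{-σ}‖ = Σ |z|^{s(n)} n^{-σ} = ζ(σ)^{|z|} F(σ, |z|) ≤ (σ/(σ−1))^{|z|} e^{30 S (1+R)^{3/2}}
≤ e^{(30 S + 1)(1+R)^{3/2}} (σ − 1)^{-R}` (`ζ(σ) ≤ σ/(σ−1)`, `σ^R ≤ 2^R ≤ e^{(1+R)^{3/2}}`). -/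
theorem tsum_norm_term_le {z : ℂ} {R σ : ℝ} (hz : ‖z‖ ≤ R) (hσ : 1 < σ) (hσ2 : σ ≤ 2) :
    ∑' n, ‖term (fun n : ℕ ↦ z ^ (n.factorization.sum fun _ v => min v 2)) σ n‖ ≤
      Real.exp ((30 * (∑' p : Nat.Primes, ((p : ℕ) : ℝ) ^ (-(6 / 5 : ℝ))) + 1) *
        (1 + R) ^ (3 / 2 : ℝ)) / (σ - 1) ^ R := by
  set a : ℂ → ℕ → ℂ := fun w n ↦ w ^ (n.factorization.sum fun _ v => min v 2) with ha
  set S : ℝ := ∑' p : Nat.Primes, ((p : ℕ) : ℝ) ^ (-(6 / 5 : ℝ)) with hS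
  change ∑' n, ‖term (a z) σ n‖ ≤ Real.exp ((30 * S + 1) * (1 + R) ^ (3 / 2 : ℝ)) / (σ - 1) ^ R
  have hr0 : 0 ≤ ‖z‖ := norm_nonneg _
  have hR : 0 ≤ R := hr0.trans hz
  have hσ' : 1 < (σ : ℂ).re := by simpa using hσ
  have hσ1 : 0 < σ - 1 := by linarith
  -- `‖a_z(n) n^{-σ}‖ = ‖a_r(n) n^{-σ}‖ = a_r(n) n^{-σ}` (`r = |z|`)
  have hnorm : ∀ n, ‖term (a z) (σ : ℂ) n‖ = ‖term (a (‖z‖ : ℂ)) (σ : ℂ) n‖ := fun n ↦ by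
    simp only [ha, norm_term_eq, norm_pow, Complex.norm_real, Real.norm_of_nonneg hr0]
  have hterm : ∀ n, term (a (‖z‖ : ℂ)) (σ : ℂ) n = ((‖term (a (‖z‖ : ℂ)) (σ : ℂ) n‖ : ℝ) : ℂ) := by
    intro n
    rcases eq_or_ne n 0 with rfl | hn
    · simp
    simp only [ha, term_of_ne_zero hn]
    rw [norm_div, norm_pow, Complex.norm_real, Real.norm_of_nonneg hr0,
      norm_natCast_cpow_of_pos (Nat.pos_of_ne_zero hn), ofReal_re, ofReal_div, ofReal_pow,
      ofReal_cpow (Nat.cast_nonneg _), ofReal_natCast]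
  have hL : LSeries (a (‖z‖ : ℂ)) (σ : ℂ) = ((∑' n, ‖term (a (‖z‖ : ℂ)) (σ : ℂ) n‖ : ℝ) : ℂ) := by
    rw [LSeries, ofReal_tsum]
    exact tsum_congr hterm
  have heq : ∑' n, ‖term (a z) (σ : ℂ) n‖ = ‖LSeries (a (‖z‖ : ℂ)) (σ : ℂ)‖ := by
    rw [hL, Complex.norm_real, Real.norm_of_nonneg (tsum_nonneg fun n ↦ norm_nonneg _)]
    exact tsum_congr hnorm
  rw [heq, ha, LSeries_eq (‖z‖ : ℂ) hσ', norm_mul]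
  -- `‖ζ(σ)^r‖ ≤ (σ/(σ-1))^r ≤ (σ/(σ-1))^R ≤ 2^R/(σ-1)^R`
  have hpos : 0 < σ / (σ - 1) := div_pos (by linarith) hσ1
  have hone : 1 ≤ σ / (σ - 1) := (one_le_div hσ1).2 (by linarith)
  have hzeta : ‖SelbergDelange.zetaPow (‖z‖ : ℂ) (σ : ℂ)‖ ≤ 2 ^ R / (σ - 1) ^ R := by
    rw [SelbergDelange.zetaPow_eq_exp_eulerLogZeta _ hσ', norm_exp, re_ofReal_mul]
    calc Real.exp (‖z‖ * (eulerLogZeta σ).re) ≤ Real.exp (‖z‖ * Real.log (σ / (σ - 1))) := by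
          rw [Real.exp_le_exp]
          refine mul_le_mul_of_nonneg_left ?_ hr0
          calc (eulerLogZeta σ).re ≤ ‖eulerLogZeta σ‖ := re_le_norm _
            _ ≤ Real.log ((σ : ℂ).re / ((σ : ℂ).re - 1)) := SatheSelberg.norm_eulerLogZeta_le hσ'
            _ = Real.log (σ / (σ - 1)) := by simp
      _ = (σ / (σ - 1)) ^ ‖z‖ := by rw [Real.rpow_def_of_pos hpos, mul_comm]
      _ ≤ (σ / (σ - 1)) ^ R := Real.rpow_le_rpow_of_exponent_le hone hz
      _ = σ ^ R / (σ - 1) ^ R := Real.div_rpow (by linarith) hσ1.le R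
      _ ≤ 2 ^ R / (σ - 1) ^ R :=
          div_le_div_of_nonneg_right (Real.rpow_le_rpow (by linarith) hσ2 hR)
            (Real.rpow_nonneg hσ1.le R)
  -- `‖F(σ, r)‖ ≤ exp(30 S (1+R)^{3/2})`
  have hrn : ‖(‖z‖ : ℂ)‖ ≤ R := by rwa [Complex.norm_real, Real.norm_of_nonneg hr0]
  have hF := norm_tprod_factor_le (s := (σ : ℂ)) (by simp; linarith) hrn
  -- `2^R ≤ exp((1+R)^{3/2})`
  have h2R : (2 : ℝ) ^ R ≤ Real.exp ((1 + R) ^ (3 / 2 : ℝ)) := by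
    rw [Real.rpow_def_of_pos two_pos, Real.exp_le_exp, show (3 / 2 : ℝ) = 1 + 1 / 2 by norm_num,
      Real.rpow_add' (by linarith) (by norm_num), Real.rpow_one, ← Real.sqrt_eq_rpow]
    have hl2 : Real.log 2 ≤ 1 := by have := Real.log_two_lt_d9; linarith
    have hs1 : 1 ≤ Real.sqrt (1 + R) := Real.one_le_sqrt.2 (by linarith)
    nlinarith [Real.log_pos one_lt_two, mul_le_mul_of_nonneg_left hs1 (by linarith : (0 : ℝ) ≤ 1 + R)]
  calc ‖SelbergDelange.zetaPow (‖z‖ : ℂ) (σ : ℂ)‖ * ‖∏' p : Nat.Primes, (1 + (‖z‖ : ℂ) * (p : ℂ) ^ (-(σ : ℂ)) +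
        (‖z‖ : ℂ) ^ 2 * ((p : ℂ) ^ (-(σ : ℂ))) ^ 2 / (1 - (p : ℂ) ^ (-(σ : ℂ)))) *
          exp ((‖z‖ : ℂ) * log (1 - (p : ℂ) ^ (-(σ : ℂ))))‖
      ≤ 2 ^ R / (σ - 1) ^ R * Real.exp (30 * S * (1 + R) ^ (3 / 2 : ℝ)) :=
        mul_le_mul hzeta hF (norm_nonneg _) (by positivity)
    _ ≤ Real.exp ((1 + R) ^ (3 / 2 : ℝ)) / (σ - 1) ^ R * Real.exp (30 * S * (1 + R) ^ (3 / 2 : ℝ)) := by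
        gcongr
    _ = Real.exp ((30 * S + 1) * (1 + R) ^ (3 / 2 : ℝ)) / (σ - 1) ^ R := by
        rw [div_mul_eq_mul_div]
        simp only [← Real.exp_add]
        congr 1
        congr 1
        ring

end CappedEuler

open CappedEuler in
/-- **Stub 1a (the capped Euler product as engine data), PROVED.**  There is `b ≥ 0` (namely
`b = 30 Σ_p p^{-6/5} + 1`) such that for every `R ≥ 0` and every `‖z‖ ≤ R` the coefficients
`a(n) = z^{s(n)}`, `s(n) = Σ_{p^v∥n} min(v,2)`, satisfy the hypotheses
`SelbergDelange.RieszData R (4/5) B z a G` of the tree's Selberg–Delange contour engine with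
`B = exp(b (1 + R)^{3/2})` and
`G(s) = F(s, z) = ∏_p (1 + z p^{−s} + z² p^{−2s}/(1 − p^{−s}))·exp(z·Log(1 − p^{−s}))`:
`G` is holomorphic with `‖G(s)‖ ≤ B` on `σ > 4/5`, `Σ a(n) n^{−s}` converges absolutely and equals
`zetaPow z s · G(s)` for `σ > 1`, and `Σ ‖a(n)‖ n^{−σ} ≤ B (σ − 1)^{−R}` for `1 < σ ≤ 2`. -/
theorem stub_cappedEulerData :
    ∃ b : ℝ, 0 ≤ b ∧ ∀ R : ℝ, 0 ≤ R → ∀ z : ℂ, ‖z‖ ≤ R → ∃ G : ℂ → ℂ,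
      SelbergDelange.RieszData R (4 / 5) (Real.exp (b * (1 + R) ^ (3 / 2 : ℝ))) z
        (fun n : ℕ => z ^ (n.factorization.sum fun _ v => min v 2)) G := by
  set S : ℝ := ∑' p : Nat.Primes, ((p : ℕ) : ℝ) ^ (-(6 / 5 : ℝ)) with hS
  have hS0 : 0 ≤ S := tsum_nonneg fun p ↦ Real.rpow_nonneg (Nat.cast_nonneg _) _
  refine ⟨30 * S + 1, by positivity, fun R hR z hz ↦ ⟨fun s ↦ ∏' p : Nat.Primes,
    (1 + z * (p : ℂ) ^ (-s) + z ^ 2 * ((p : ℂ) ^ (-s)) ^ 2 / (1 - (p : ℂ) ^ (-s))) *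
      exp (z * log (1 - (p : ℂ) ^ (-s))), hz, differentiableOn_tprod_factor z (by norm_num),
    fun s hs ↦ ?_, fun σ hσ ↦ ?_, fun s hs ↦ LSeries_eq z hs, fun σ hσ hσ2 ↦ tsum_norm_term_le hz hσ hσ2⟩⟩
  · refine (norm_tprod_factor_le hs hz).trans (Real.exp_le_exp.2 ?_)
    have hM0 : 0 ≤ (1 + R) ^ (3 / 2 : ℝ) := Real.rpow_nonneg (by linarith) _
    nlinarith
  · exact (summable_norm_term z (by simpa using hσ)).of_norm

end Summit.Parity.BatemanHorn.Cruxes.LinearCappedRepulsion.JensenStieltjesMajorant
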